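import Summits.HubbardSuperconductivity.HubbardSuperconductivity.Theorems.AnisotropyChordTransferFibre3FinX5Eval

/-!
# Route `AnisotropyChord` / H0 rotor rung: FIN per-`L` GM₃ (X5), `L = 31` — row-C cell facts (X5, point wedges), part `p25`

Kernel facts `xcCellAnyA0 31 (49/50) 100 la lb bn tb = true` (row C of cert cells 70, 71 of `L = 31` with `b = bn/100` and the `T⁺·D` brackets `tb` exported by the row-`N₁` facts `xn31_*`): the two Green point wedges `gWedgePt` are recomputed in the kernel, the profile / gradient tables are built from them by monotonicity (`…FinX5Eval`), and g5's row-C check is decided; assembled in `…FinX5GM3ThirtyOne`.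
Prover seat `hubbard-h0-rotor-p3` g8; helper for piece A = stmt-HubbardSuperconductivity-23918 of rung 19089 (`--supports`, helper class).
WHAT THIS IS NOT: nothing here proves superconductivity in the Hubbard model (rotor TARGET as worded stays FALSE, g15 verdict); kernel facts for the FIN certificate of ONE conditional reduction.  Tree imports only; zero data; standard axioms.
-/

set_option linter.dupNamespace false
set_option autoImplicit false

namespace Summit.HubbardSuperconductivity.HubbardSuperconductivity.Theorems.AnisotropyChord.Transfer.Fibre3

namespace FinXD

open FinXB FinCell Hole2

set_option maxHeartbeats 4000000 in
/-- row C of cell 70 of `L = 31` (`b = 61/100`). [folklore] -/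
theorem xc31_70 : xcCellAnyA0 31 (49/50 : ℚ) 100 305563534814215 313202623184571 61 ((915566449238966 : ℤ), (941754781965581 : ℤ)) = true := by decide +kernel

set_option maxHeartbeats 4000000 in
/-- row C of cell 71 of `L = 31` (`b = 61/100`). [folklore] -/
theorem xc31_71 : xcCellAnyA0 31 (49/50 : ℚ) 100 313202623184571 321032688764186 61 ((938524997754507 : ℤ), (965278949800739 : ℤ)) = true := by decide +kernel

end FinXD

end Summit.HubbardSuperconductivity.HubbardSuperconductivity.Theorems.AnisotropyChord.Transfer.Fibre3
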